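import Literature.MathematicalPhysics.QuantumFieldTheory.Balaban1983to89.B9Thm37AllNorms
import Literature.MathematicalPhysics.QuantumFieldTheory.Balaban1983to89.B9SectDL2Decay

/-!
# `Balaban1983to89.B9Thm37AllNormsInstances` — [B9] Theorem 3.7 (pp. 408–410): the legs h_□G′_□h_□ of (3.87) in the
# three concrete block norms of (3.42)–(3.46) — sharp-block sup sizes ((3.42)), block-L² sizes ((3.46),
# `B9SectDL2Decay.l2w`) and probe lattices of linear functionals (the Hölder quotients of (3.40)/(3.43)) — i.e. the
# hypotheses `hin`/`hin'`/`hout` of `B9Thm37AllNorms.leg_of_sandwich` DISCHARGED for these norms (dictionary file)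

T. Bałaban, *Propagators for lattice gauge theories in a background field*, Commun. Math. Phys. **99**, 389–434 (1985)
[Balaban1985BackgroundPropagators]; [4] = [Balaban1984PropagatorsII].

statement-level skeleton of published theorems with citation tags; proofs where landed; nothing here is a claim about the Yang–Mills mass gap

CITATION HEADER (lean-in-tree rule).  Printed loci (all certified in the headers of `…B9Thm37Sum` / `…B9Thm37AllNorms` /
`…B9SectDL2Decay`): (3.87) p. 409 *"G′₀ = Σ_{□∈𝒟} h_□G′_□h_□"* with p. 408 *"We take the partition of unity {h_□} … Σ_□h²_□
= 1"*; p. 409 *"The operators constructed for this sequence, which we denote by G′_□(U), … satisfy all the inequalities of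
Theorems 3.1–3.3 correspondingly"* (Corollary 3.6 for the local operators); the norms: (3.42) p. 397 (sup over Δ(y)),
(3.46) p. 398 *"‖hG′(U)λ‖, … ≤ B₀[(L^jη)², …]|h|e^{−δ₀d(y,y′)}‖λ‖ for supp h ⊂ Δ(y), y ∈ Λ_j, supp λ ⊂ Δ(y′)"* (block
L²), (3.40)/(3.43) pp. 397–398 (Hölder quotients with parallel transport — each quotient is ONE linear functional of
the output, anchored at y; cell lit-balaban r06 `B9Thm34HolderLeftFinal`: *"every (3.40)-type functional Φ"*).

WHAT THIS FILE CERTIFIES (0 sorry; theorems only; no `def`).  For the leg Φ(h_□G′_□h_□) of `B9Thm37AllNorms.leg_of_sandwich`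
/ `thm37_left` (hypotheses: multiplication by h_□ preserves the input localisation and sizes — `hin`, `hin'` — and,
after the reading map Φ, kills the output sizes off S_□ without increasing them — `hout`):
* §1 SUP sizes `BlockNorm.ofBlocks` ((3.42)): `ofBlocks_loc_mulOp_support` (`hout` for Φ = 1) and **`leg_ofBlocks`** —
  from Cor. 3.6's sup member for G′_□ (an `HasMaj` between sharp blocks) to the localized leg 1_{S_□}(y)K of h_□G′_□h_□
  (the `HasMaj` form of `B9Thm37Sum.hasMajorant_sandwich_local`).
* §2 BLOCK-L² sizes `B9SectDL2Decay.l2w` ((3.46)): `bsq_mono`/`bl2_mono` (pointwise domination on the block ⇒ smaller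
  block-L² size), `l2w_isLoc_mulOp`, `l2w_loc_mulOp_le`, `l2w_loc_mulOp_support` and **`leg_l2w`** — from Cor. 3.6's
  (3.46) member for G′_□ between two weighted block-L² norms to the localized leg of h_□G′_□h_□; the a-priori bound of
  `thm37_left` for these norms is `B9SectDL2Decay.exists_hasMaj_l2w_const`.
* §3 PROBE LATTICES (the Hölder members (3.43)/(3.45) read per functional): for a finite family of linear functionals
  φ_p of the output with anchors `blkP p` (e.g. the transported Hölder quotients of (3.40) at pairs x, x′ ∈ Δ̃(y)),
  `Φ := LinearMap.pi φ` into the lattice `P → ℝ` with the sup sizes `ofBlocks blkP`: **`hasMaj_probe_iff`** — an `HasMaj`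
  into this norm IS the family of per-functional bounds |φ_p(Tμ)| ≤ K(y_p, y′)·(size of μ); so `thm37_left` with
  `b₂ = ofBlocks blkP`, `E = LinearMap.pi φ ∘ ∇_U` is the (3.43) member of the expansion, functional by functional.
* §4 (v1.1, append-only) READING BACK: `hasMajorantHom_of_hasMaj` / `hasMaj_ofBlocks_iff_hasMajorant` — an `HasMaj` between
  sharp-block sup sizes (K ≥ 0) IS a `B6RandomWalkHom.HasMajorantHom` / `B6RandomWalk.HasMajorant`, so the conclusions of
  `thm37_left`/`thm37_right`/`thm37_twoSided` at sharp blocks are the printed sup shapes of (3.42) as the lineage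
  `…B9Thm37Glue` / the reading adapters `B9Thm37GlueCor36` consume them.

HONEST SCOPE.  Dictionary only: no operator of the paper is constructed; which functionals φ_p, weights W and cut-offs
realise (3.43)/(3.46) for a concrete lattice is the consumer's (as in r06's Sect. B files).  Value = kernel-checked
bookkeeping, NOT summit progress; nothing continuum, nothing about the mass gap.  Seat `pub-ymgap-dag-n06-b` (HUMAN
RULING D-0062, node N06), 2026-08-25; rows B9.Thm3.7 × (3.42)/(3.43)/(3.46) (cells only).
-/

namespace Literature.MathematicalPhysics.QuantumFieldTheory.Balaban1983to89.B9Thm37AllNormsInstances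

open Literature.MathematicalPhysics.QuantumFieldTheory.Balaban1983to89
open Finset B6RandomWalk B9Thm37Sum B11SectG B9Thm37AllNorms B9SectDL2Decay

noncomputable section

/-! ## §1  Sharp-block sup sizes ((3.42)): the leg of (3.87) from Corollary 3.6's sup member -/

section SupSizes

variable {G : B6.Geometry} {X : Type} [Fintype X]

/-- A function vanishing on the block of y has sharp-block size 0 there. [cite: Balaban1984PropagatorsII, (2.51) p.232] -/
theorem ofBlocks_loc_eq_zero_of_vanish (blk : X → G.Site) (y : G.Site) {f : X → ℝ}
    (hf : ∀ x, blk x = y → f x = 0) : (BlockNorm.ofBlocks G blk).loc y f = 0 := by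
  classical
  refine le_antisymm ?_ ((BlockNorm.ofBlocks G blk).loc_nonneg y f)
  show (⨆ x : X, if blk x = y then |f x| else 0) ≤ 0
  by_cases hX : Nonempty X
  · refine ciSup_le fun x => ?_
    split_ifs with hx
    · rw [hf x hx, abs_zero]
    · exact le_rfl
  · rw [not_nonempty_iff] at hX
    simp only [iSup_of_empty', Real.sSup_empty, le_refl]

variable [DecidableEq G.Site]

/-- Multiplication by h with |h| ≤ 1 and supp h within the blocks of S kills the sharp-block sup sizes off S without
increasing them (`hout` of `B9Thm37AllNorms.leg_of_sandwich` for Φ = 1). [cite: Balaban1985BackgroundPropagators, (3.87) p.409] -/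
theorem ofBlocks_loc_mulOp_support (blk : X → G.Site) (h : X → ℝ) (hh : ∀ x, |h x| ≤ 1) (S : Finset G.Site)
    (hS : ∀ x, h x ≠ 0 → blk x ∈ S) (y : G.Site) (ν : X → ℝ) :
    (BlockNorm.ofBlocks G blk).loc y (mulOp h ν) ≤
      (if y ∈ S then (1 : ℝ) else 0) * (BlockNorm.ofBlocks G blk).loc y ν := by
  by_cases hy : y ∈ S
  · rw [if_pos hy, one_mul]
    exact ofBlocks_loc_mulOp_le blk y h hh ν
  · rw [if_neg hy, zero_mul]
    refine le_of_eq (ofBlocks_loc_eq_zero_of_vanish blk y fun x hx => ?_)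
    have h0 : h x = 0 := by
      by_contra hne
      exact hy (hx ▸ hS x hne)
    rw [mulOp_apply, h0, zero_mul]

/-- **The sup leg of (3.87)**: if G′_□ obeys a sup member of Corollary 3.6 between the sharp blocks (majorant K ≥ 0),
|h_□| ≤ 1 and supp h_□ lies within the blocks of S_□, then h_□G′_□h_□ has the localized majorant 1_{S_□}(y)K(y,y′) — the
`hleg` of `B9Thm37AllNorms.thm37_left` for E = 1 and the sup sizes (the `HasMaj` form of
`B9Thm37Sum.hasMajorant_sandwich_local`). [cite: Balaban1985BackgroundPropagators, (3.87) p.409, Cor. 3.6 pp.408–409] -/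
theorem leg_ofBlocks (blk : X → G.Site) {Gop : Module.End ℝ (X → ℝ)} {K : G.Site → G.Site → ℝ}
    (hK : ∀ a c, 0 ≤ K a c) (hG : HasMaj (BlockNorm.ofBlocks G blk) (BlockNorm.ofBlocks G blk) Gop K)
    (h : X → ℝ) (hh : ∀ x, |h x| ≤ 1) (S : Finset G.Site) (hS : ∀ x, h x ≠ 0 → blk x ∈ S) :
    HasMaj (BlockNorm.ofBlocks G blk) (BlockNorm.ofBlocks G blk) (mulOp h * Gop * mulOp h)
      (fun a c => if a ∈ S then K a c else 0) := by
  have hG' : HasMaj (BlockNorm.ofBlocks G blk) (BlockNorm.ofBlocks G blk) (LinearMap.id ∘ₗ Gop) K :=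
    hG.congr fun μ => rfl
  have h1 := leg_of_sandwich (BlockNorm.ofBlocks G blk) (BlockNorm.ofBlocks G blk) LinearMap.id (Mh := mulOp h)
    hK hG' S (fun y' μ hμ => ofBlocks_isLoc_mulOp blk h y' μ hμ) (fun y' μ => ofBlocks_loc_mulOp_le blk y' h hh μ)
    (fun y ν => ofBlocks_loc_mulOp_support blk h hh S hS y ν)
  exact h1.congr fun μ => rfl

end SupSizes

/-! ## §2  Block-L² sizes ((3.46), `B9SectDL2Decay.l2w`): the leg of (3.87) from Corollary 3.6's L² member -/

section L2Sizes

variable {G : B6.Geometry} {X : Type} [Fintype X]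

/-- Pointwise domination on the block ⇒ smaller squared block size. [cite: Balaban1985BackgroundPropagators, (3.46) p.398] -/
theorem bsq_mono (blk : X → G.Site) (y : G.Site) {f g : X → ℝ} (h : ∀ x, blk x = y → |f x| ≤ |g x|) :
    bsq blk y f ≤ bsq blk y g := by
  classical
  unfold bsq
  refine Finset.sum_le_sum fun x _ => ?_
  split_ifs with hx
  · have := h x hx
    calc f x ^ 2 = |f x| ^ 2 := (sq_abs _).symm
      _ ≤ |g x| ^ 2 := pow_le_pow_left₀ (abs_nonneg _) this 2
      _ = g x ^ 2 := sq_abs _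
  · exact le_rfl

/-- Pointwise domination on the block ⇒ smaller block-L² size. [cite: Balaban1985BackgroundPropagators, (3.46) p.398] -/
theorem bl2_mono (blk : X → G.Site) (y : G.Site) {f g : X → ℝ} (h : ∀ x, blk x = y → |f x| ≤ |g x|) :
    bl2 blk y f ≤ bl2 blk y g := by
  unfold bl2
  exact Real.sqrt_le_sqrt (bsq_mono blk y h)

/-- A function vanishing on the block of y has block-L² size 0 there. [cite: Balaban1985BackgroundPropagators, (3.46) p.398] -/
theorem bl2_eq_zero_of_vanish (blk : X → G.Site) (y : G.Site) {f : X → ℝ} (hf : ∀ x, blk x = y → f x = 0) :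
    bl2 blk y f = 0 := by
  have hle : bl2 blk y f ≤ bl2 blk y (0 : X → ℝ) :=
    bl2_mono blk y fun x hx => by rw [hf x hx, Pi.zero_apply]
  rw [bl2_zero] at hle
  exact le_antisymm hle (bl2_nonneg _ _ _)

/-- Multiplication by h preserves *"supp λ ⊂ Δ(y′)"* in the block-L² norms (`hin`). [cite: Balaban1985BackgroundPropagators, (3.46) p.398] -/
theorem l2w_isLoc_mulOp (blk : X → G.Site) (W : G.Site → ℝ) (hW : ∀ y, 0 ≤ W y) (h : X → ℝ) (y' : G.Site)
    (μ : X → ℝ) (hμ : (l2w G blk W hW).IsLoc y' μ) : (l2w G blk W hW).IsLoc y' (mulOp h μ) := by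
  rw [l2w_isLoc_iff] at hμ ⊢
  intro x hx
  rw [mulOp_apply, hμ x hx, mul_zero]

/-- Multiplication by |h| ≤ 1 does not increase the weighted block-L² sizes (`hin'`; the factor |h| of (3.46) for
|h| ≤ 1). [cite: Balaban1985BackgroundPropagators, (3.46) p.398] -/
theorem l2w_loc_mulOp_le (blk : X → G.Site) (W : G.Site → ℝ) (hW : ∀ y, 0 ≤ W y) (y : G.Site) (h : X → ℝ)
    (hh : ∀ x, |h x| ≤ 1) (μ : X → ℝ) :
    (l2w G blk W hW).loc y (mulOp h μ) ≤ (l2w G blk W hW).loc y μ := by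
  rw [l2w_loc, l2w_loc]
  refine mul_le_mul_of_nonneg_left (bl2_mono blk y fun x _ => ?_) (hW y)
  rw [mulOp_apply, abs_mul]
  calc |h x| * |μ x| ≤ 1 * |μ x| := mul_le_mul_of_nonneg_right (hh x) (abs_nonneg _)
    _ = |μ x| := one_mul _

variable [DecidableEq G.Site]

/-- Multiplication by h (|h| ≤ 1, supp h within the blocks of S) kills the weighted block-L² sizes off S without
increasing them (`hout` for Φ = 1). [cite: Balaban1985BackgroundPropagators, (3.46) p.398] -/
theorem l2w_loc_mulOp_support (blk : X → G.Site) (W : G.Site → ℝ) (hW : ∀ y, 0 ≤ W y) (h : X → ℝ)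
    (hh : ∀ x, |h x| ≤ 1) (S : Finset G.Site) (hS : ∀ x, h x ≠ 0 → blk x ∈ S) (y : G.Site) (ν : X → ℝ) :
    (l2w G blk W hW).loc y (mulOp h ν) ≤ (if y ∈ S then (1 : ℝ) else 0) * (l2w G blk W hW).loc y ν := by
  by_cases hy : y ∈ S
  · rw [if_pos hy, one_mul]
    exact l2w_loc_mulOp_le blk W hW y h hh ν
  · rw [if_neg hy, zero_mul, l2w_loc]
    refine le_of_eq ?_
    rw [bl2_eq_zero_of_vanish blk y fun x hx => ?_, mul_zero]
    have h0 : h x = 0 := by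
      by_contra hne
      exact hy (hx ▸ hS x hne)
    rw [mulOp_apply, h0, zero_mul]

/-- **The L² leg of (3.87)**: if G′_□ obeys an L² member of Corollary 3.6 between two weighted block-L² norms
(majorant K ≥ 0; (3.46) for the local operator, p. 409), |h_□| ≤ 1 and supp h_□ lies within the blocks of S_□, then
h_□G′_□h_□ has the localized majorant 1_{S_□}(y)K(y,y′) between the same norms — the `hleg` of
`B9Thm37AllNorms.thm37_left` for E = 1 and b₁ = b₂ = block-L² sizes; the a-priori bound there is
`B9SectDL2Decay.exists_hasMaj_l2w_const`. [cite: Balaban1985BackgroundPropagators, (3.87) p.409, (3.46) p.398] -/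
theorem leg_l2w (blk : X → G.Site) (W₁ W₂ : G.Site → ℝ) (hW₁ : ∀ y, 0 ≤ W₁ y) (hW₂ : ∀ y, 0 ≤ W₂ y)
    {Gop : Module.End ℝ (X → ℝ)} {K : G.Site → G.Site → ℝ} (hK : ∀ a c, 0 ≤ K a c)
    (hG : HasMaj (l2w G blk W₁ hW₁) (l2w G blk W₂ hW₂) Gop K)
    (h : X → ℝ) (hh : ∀ x, |h x| ≤ 1) (S : Finset G.Site) (hS : ∀ x, h x ≠ 0 → blk x ∈ S) :
    HasMaj (l2w G blk W₁ hW₁) (l2w G blk W₂ hW₂) (mulOp h * Gop * mulOp h)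
      (fun a c => if a ∈ S then K a c else 0) := by
  have hG' : HasMaj (l2w G blk W₁ hW₁) (l2w G blk W₂ hW₂) (LinearMap.id ∘ₗ Gop) K := hG.congr fun μ => rfl
  have h1 := leg_of_sandwich (l2w G blk W₁ hW₁) (l2w G blk W₂ hW₂) LinearMap.id (Mh := mulOp h) hK hG' S
    (fun y' μ hμ => l2w_isLoc_mulOp blk W₁ hW₁ h y' μ hμ) (fun y' μ => l2w_loc_mulOp_le blk W₁ hW₁ y' h hh μ)
    (fun y ν => l2w_loc_mulOp_support blk W₂ hW₂ h hh S hS y ν)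
  exact h1.congr fun μ => rfl

end L2Sizes

/-! ## §3  Probe lattices: the Hölder members (3.43)/(3.45) read functional by functional -/

section Probes

variable {G : B6.Geometry} {F₁ F : Type} [AddCommGroup F₁] [Module ℝ F₁] [AddCommGroup F] [Module ℝ F]
variable {P : Type} [Fintype P]

/-- **A majorant into a probe lattice IS a family of per-functional bounds.**  For a finite family of linear
functionals φ_p of the output with anchors `blkP p` (for (3.43): p = a pair x ≠ x′ in Δ̃(y) with the transported
Hölder quotient (3.40) cut off by ζ, anchored at y — cell lit-balaban r06's *"every (3.40)-type functional Φ"*), the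
operator T : F₁ → F read through `LinearMap.pi φ` into the lattice P → ℝ with its sharp-block sup sizes has the majorant
K ≥ 0 iff |φ_p(Tμ)| ≤ K(y_p, y′)·(size of μ) for every probe p and every μ localized at y′.  So `B9Thm37AllNorms.thm37_left`
with `b₂ = BlockNorm.ofBlocks G blkP` and `E = LinearMap.pi φ ∘ₗ E₀` is the Hölder member of the expansion (3.90) for
the seminorm sup_p |φ_p(·)|. [cite: Balaban1985BackgroundPropagators, (3.40) p.397, (3.43) p.398, Thm 3.7 p.409] -/
theorem hasMaj_probe_iff (b₁ : BlockNorm G F₁) (blkP : P → G.Site) (φ : P → (F →ₗ[ℝ] ℝ)) (T : F₁ →ₗ[ℝ] F)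
    {K : G.Site → G.Site → ℝ} (hK : ∀ a c, 0 ≤ K a c) :
    HasMaj b₁ (BlockNorm.ofBlocks G blkP) (LinearMap.pi φ ∘ₗ T) K ↔
      ∀ (y' : G.Site) (μ : F₁), b₁.IsLoc y' μ → ∀ p : P, |φ p (T μ)| ≤ K (blkP p) y' * b₁.loc y' μ := by
  classical
  constructor
  · intro h y' μ hμ p
    have hb := h y' μ hμ (blkP p)
    have hsup : |φ p (T μ)| ≤ (BlockNorm.ofBlocks G blkP).loc (blkP p) ((LinearMap.pi φ ∘ₗ T) μ) := by
      show |φ p (T μ)| ≤ ⨆ p' : P, if blkP p' = blkP p then |(LinearMap.pi φ ∘ₗ T) μ p'| else 0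
      refine le_trans (le_of_eq ?_) (le_ciSup (Finite.bddAbove_range _) p)
      simp [LinearMap.pi_apply]
    exact hsup.trans hb
  · intro h y' μ hμ y
    show (⨆ p : P, if blkP p = y then |(LinearMap.pi φ ∘ₗ T) μ p| else 0) ≤ K y y' * b₁.loc y' μ
    have h0 : 0 ≤ K y y' * b₁.loc y' μ := mul_nonneg (hK _ _) (b₁.loc_nonneg _ _)
    by_cases hP : Nonempty P
    · refine ciSup_le fun p => ?_
      split_ifs with hp
      · have := h y' μ hμ p
        rw [hp] at this
        simpa [LinearMap.pi_apply] using this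
      · exact h0
    · rw [not_nonempty_iff] at hP
      simp only [iSup_of_empty', Real.sSup_empty]
      exact h0

end Probes

/-! ## §4  Back to the sup shapes of (3.42): reading an `HasMaj` between sharp blocks as a two-space sup majorant
(v1.1 addendum, append-only) -/

section Reading

open B6RandomWalkHom

variable {G : B6.Geometry} {X Z : Type} [Fintype X] [Fintype Z]

/-- The sharp-block size of y′ bounds |μ| on the block of y′. [cite: Balaban1984PropagatorsII, (2.51) p.232] -/
theorem abs_apply_le_ofBlocks_loc (blk : X → G.Site) (y' : G.Site) (μ : X → ℝ) (x : X) (hx : blk x = y') :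
    |μ x| ≤ (BlockNorm.ofBlocks G blk).loc y' μ := by
  classical
  show |μ x| ≤ ⨆ x : X, if blk x = y' then |μ x| else 0
  refine le_trans ?_ (le_ciSup (Finite.bddAbove_range _) x)
  simp [hx]

/-- A `BlockSupp` datum of [4] (2.51) bounds the sharp-block size: supp μ ⊂ Δ(y′), |μ| ≤ B ⇒ loc_{y′} μ ≤ B.
[cite: Balaban1984PropagatorsII, (2.51) p.232] -/
theorem ofBlocks_loc_le_of_blockSupp (blk : X → G.Site) {y' : G.Site} {μ : X → ℝ} {B : ℝ}
    (hμ : BlockSupp blk μ y' B) : (BlockNorm.ofBlocks G blk).loc y' μ ≤ B := by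
  classical
  show (⨆ x : X, if blk x = y' then |μ x| else 0) ≤ B
  by_cases hX : Nonempty X
  · refine ciSup_le fun x => ?_
    split_ifs with hx
    · exact hμ.bound x hx
    · exact hμ.nonneg
  · rw [not_nonempty_iff] at hX
    simp only [iSup_of_empty', Real.sSup_empty]
    exact hμ.nonneg

/-- **Reading back**: an `HasMaj` majorant K ≥ 0 between the sharp-block sup sizes of two lattices IS a two-space sup
majorant `B6RandomWalkHom.HasMajorantHom` of the lineage `…B9Thm37Glue` (the converse of
`B9Thm37AllNorms.hasMaj_of_hasMajorantHom`) — so the conclusions of `thm37_left` / `thm37_right` / `thm37_twoSided` at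
`b = BlockNorm.ofBlocks …` are the printed sup shapes *"|(Tλ)(x)| ≤ K(y,y′)|λ| for x ∈ Δ(y), supp λ ⊂ Δ(y′)"* of (3.42).
[cite: Balaban1985BackgroundPropagators, (3.42) p.397; Balaban1984PropagatorsII, (2.51) p.232] -/
theorem hasMajorantHom_of_hasMaj (blk : X → G.Site) (blkZ : Z → G.Site) {T : (X → ℝ) →ₗ[ℝ] (Z → ℝ)}
    {K : G.Site → G.Site → ℝ} (hK : ∀ a c, 0 ≤ K a c)
    (h : HasMaj (BlockNorm.ofBlocks G blk) (BlockNorm.ofBlocks G blkZ) T K) : HasMajorantHom blk blkZ T K := by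
  intro y' μ B hμ z
  have hloc : (BlockNorm.ofBlocks G blk).IsLoc y' μ := fun x hx => hμ.off x hx
  have hb := h y' μ hloc (blkZ z)
  calc |T μ z| ≤ (BlockNorm.ofBlocks G blkZ).loc (blkZ z) (T μ) := abs_apply_le_ofBlocks_loc blkZ (blkZ z) (T μ) z rfl
    _ ≤ K (blkZ z) y' * (BlockNorm.ofBlocks G blk).loc y' μ := hb
    _ ≤ K (blkZ z) y' * B := mul_le_mul_of_nonneg_left (ofBlocks_loc_le_of_blockSupp blk hμ) (hK _ _)

/-- The one-lattice case: `HasMaj` between sharp blocks with K ≥ 0 ⇔ `B6RandomWalk.HasMajorant` ([4] (2.51)).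
[cite: Balaban1984PropagatorsII, (2.51) p.232] -/
theorem hasMaj_ofBlocks_iff_hasMajorant (blk : X → G.Site) {T : Module.End ℝ (X → ℝ)} {K : G.Site → G.Site → ℝ}
    (hK : ∀ a c, 0 ≤ K a c) :
    HasMaj (BlockNorm.ofBlocks G blk) (BlockNorm.ofBlocks G blk) T K ↔ HasMajorant blk T K :=
  ⟨fun h => (hasMajorantHom_iff blk T K).mp (hasMajorantHom_of_hasMaj blk blk hK h),
    fun h => hasMaj_of_hasMajorant blk hK h⟩

end Reading

end

end Literature.MathematicalPhysics.QuantumFieldTheory.Balaban1983to89.B9Thm37AllNormsInstances
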